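import Summits.ValiantsHypothesis.ValiantsHypothesis.Theorems.NewtonUnitEquationsTwoProductsRankOneThreeGenLawShiftPlanar
import HarnessLib

/-!
# Route NewtonUnitEquations — crux `TwoProducts` (stmt-ValiantsHypothesis-5906), line `relation_ladder`, rung R7b (rank one on THREE
# letters, ALL coefficient patterns `p•α = q•β + r•γ`) + rung R7c (TWO letters with torsion): the DILATED FREE LIFT — part 5/7 — dilated letter weights and per visible point a zero-avoiding strict pencil-minimiser; the per-slice count (T7 end, T8)

(T7, end) `rWP`, `rWP_pos`, `lwt_rWP`, `lwt_split`; (T8) `RelData.sliceMin_of_visible`, `Nm8`, `sliceBd8`, `sliceCount` (val-lit-p3's `ShiftRank.pencilCount` + `BinExpSum.pencilCount_arith`, `toolBound_mono` from the R6 port).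

val-idea-8 g3 (ideator; lens decomp), 2026-08-28.  THE GENERAL THREE-LETTER RANK-ONE LAW `p•α = q•β + r•γ` (all `p, q ≥ 1`, `r ≥ 0`):
lift `α ↦ Y_b^q Y_c^r, β ↦ Y_b^p, γ ↦ Y_c^p` over the `p`-DILATED plane (`enumP : b ↦ β, c ↦ γ, i ↦ p•enum i`), fibres `k` with divisibility
guards `p ∣ x_b − qk`, `p ∣ x_c − rk`, letter count `B_k = k + (x_b−qk)/p + (x_c−rk)/p`, DOUBLE SLICING `(b₁, b₂) = (x_b, x_c)`, the coefficient
theorem with `Pfac · C(R + B_k − 1, B_k) · κ_k`, finite SHIFT RANK and val-lit-p3's `ShiftRank.pencilCount` BY NAME; large or absent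
coefficients/letters are permutation type (R3♯).  Instances: R6b (1;1,1), R6c (2;1,1), R7a (p = 1, `visible_bound_free`), R6d = val-lit-p3's
homogeneous shape (p = q + r, `visible_bound_hom`), and rung R7c = rank one on TWO letters with torsion `p•α = q•β` (`r = 0`, idle third letter).

PORT NOTE (val-lit-p3 g15, prover seat, helper mode `--supports stmt-ValiantsHypothesis-5906 --as helper`, no stub credit claimed; the author's
request val-width INBOX 12:15Z/12:19Z + desk RULING #279 (c)): part 5/7 of a VERBATIM Theorems-side port of val-idea-8 g3's sorry-free module
`Cruxes/TwoProducts/Lines/relation_ladder_R7b.lean` REV 2 (tree sha256 f9e10d1fedcbd387…; 1 890 lines; `lean check` rc 0, 0 sorries,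
0 warnings, axioms standard).  ALL mathematics and ALL proofs are val-idea-8 g3's.  Port changes only: (i) file split + import chain;
(ii) declarations re-declared verbatim from LANDED ports are referenced BY NAME instead — `R6b.sum_sgn`, `R6b.HSD` (+ six closure
lemmas), `R6b.hsd_binChar` (R6b port); `tab`, `sgn`, `toolBound_mono` (R6 port, parent namespace); `R7a.SIdx`, `R7a.card_SIdx`,
`R7a.msetT_apply_le`, `R7a.permType_of_rankOne_largeCoeff`, `R7a.permType_of_rankOne_absent` (R7a port); `rankOne_symm` =
`R6c.rankOneCoincidences_symm` (R6c); `wt_nsmul'` = `FormalLogLinearisation.wt_nsmul`; (iii) section variables α-renamed `I ↦ Ig`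
(QIdx datum), `D ↦ Dg` (RelData datum) — forced by the gate's textual statement index (`dedup.landed`), since the R6b / R7a ports own
same-text lemmas over `ThreeIdx` / `QIdx`; (iv) docstrings on API lemmas; (v) in part 7/7 the parameter-free `def RankOneThreeGenLaw : Prop`
and `def RankOneTwoLaw : Prop` are NOT declared (relocation rule) — the laws are stated by their LITERAL bodies as `rankOneThreeGenLaw_proof`
and `rankOneTwoLaw_proof`; `visible_bound_free` / `visible_bound_hom` keep their names and texts.  Namespace = the author's
(`…PermutationType.R7b`).  Nothing here closes the line's residual, the crux `TwoProducts` (5906) or `VP ≠ VNP`; no summit statement is proved.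

Honest scope (the author's): rank one on FOUR letters with general coefficients, relations on ≥ 5 letters, one-sided `p•α = Σ qᵢ βᵢ` (R8, memo
only) and coincidence rank ≥ 2 are NOT covered here.  Nothing here moves VP ≠ VNP; `TwoProducts` (5906) stays OPEN. [folklore]
-/

noncomputable section

-- Sub = Summit single-conjunct layout: the duplicated namespace component is mandated by the tree.
set_option linter.dupNamespace false
set_option linter.unusedSimpArgs false
set_option linter.deprecated false
set_option linter.unusedSectionVars false
set_option linter.unusedVariables false
set_option linter.unnecessarySeqFocus false

namespace Summit.ValiantsHypothesis.ValiantsHypothesis.Theorems.NewtonUnitEquations.TwoProducts.PermutationType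
namespace R7b
open scoped BigOperators
open MvPolynomial

variable {σ : Type*} [Fintype σ] [DecidableEq σ]

variable (Ig : QIdx σ)

section FreePlanar
open Summit.ValiantsHypothesis.ValiantsHypothesis.Theorems.NewtonUnitEquations.TwoProducts.FormalLogLinearisation
open Summit.ValiantsHypothesis.ValiantsHypothesis.Theorems.NewtonUnitEquations.TwoProducts.PlanarCell

variable {m : ℕ} {u v : Fin m → MvPolynomial (Fin 2) ℂ} (Dg : RelData u v)

/-! ### The upstairs weights: the (dilated) letter weights themselves -/

/-- Letter weights `r_i = -wt ξ (enumP i) > 0`. [folklore] -/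
def RelData.rWP (ξ : Fin 2 → ℝ) (i : Fin (sE u v)) : ℝ := -wt ξ (Dg.enumP i)

/-- `RelData.rWP_pos` — technical lemma of the R7b dilated free-lift toolkit (val-idea-8 g3). [folklore] -/
theorem RelData.rWP_pos (ξ : Fin 2 → ℝ) (hval : ValidWeight u v ξ) (i : Fin (sE u v)) : 0 < Dg.rWP ξ i := by
  unfold RelData.rWP
  by_cases hib : i = Dg.idx.b
  · subst hib; rw [Dg.enumP_b, ← Dg.enum_b]; linarith [wt_enum_neg u v ξ hval Dg.idx.b]
  by_cases hic : i = Dg.idx.c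
  · subst hic; rw [Dg.enumP_c, ← Dg.enum_c]; linarith [wt_enum_neg u v ξ hval Dg.idx.c]
  rw [Dg.enumP_other i hib hic, wt_nsmul]
  have h1 := wt_enum_neg u v ξ hval i
  have hp : (1 : ℝ) ≤ Dg.p := by exact_mod_cast Dg.hp
  nlinarith

/-- The letter weight functional is minus the planar weight of the dilated push-forward. [folklore] -/
theorem RelData.lwt_rWP (ξ : Fin 2 → ℝ) (x : Fin (sE u v) →₀ ℕ) : lwt (Dg.rWP ξ) x = -wt ξ (piE Dg.enumP x) :=
  lwt_eq_neg_wt ξ Dg.enumP x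

/-- Splitting a linear weight along the slices: `θ(x) = Σ_i θ_i x̂_i + θ_b x_b + θ_c x_c` for `x_a = 0`. [folklore] -/
theorem lwt_split (Ig : R7b.QIdx σ) (θ : σ → ℝ) (x : σ →₀ ℕ) (hx : x Ig.a = 0) :
    lwt θ x = (∑ i, θ i * ((xhat Ig x i : ℕ) : ℝ)) + θ Ig.b * ((x Ig.b : ℕ) : ℝ) + θ Ig.c * ((x Ig.c : ℕ) : ℝ) := by
  unfold lwt
  rw [sum_three_split Ig, sum_three_split Ig (fun i => θ i * ((xhat Ig x i : ℕ) : ℝ)), xhat_a, xhat_b, xhat_c, hx]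
  have hr : ∑ i ∈ rest Ig, θ i * ((x i : ℕ) : ℝ) = ∑ i ∈ rest Ig, θ i * ((xhat Ig x i : ℕ) : ℝ) := by
    refine Finset.sum_congr rfl fun j hj => ?_
    rw [xhat_rest Ig x j hj]
  rw [hr]
  push_cast
  ring

end FreePlanar

/-! ## Part T8: per visible point a zero-avoiding strict pencil-minimiser of a slice function; the fibrewise count over the
slice pairs `(b₁, b₂)` via val-lit-p3's `ShiftRank.pencilCount`; large / absent coefficients are permutation type; the arithmetic;
the law -/

section FreeCount
open Summit.ValiantsHypothesis.ValiantsHypothesis.Theorems.NewtonUnitEquations.TwoProducts.FormalLogLinearisation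
open Summit.ValiantsHypothesis.ValiantsHypothesis.Theorems.NewtonUnitEquations.TwoProducts.PlanarCell

variable {m : ℕ} {u v : Fin m → MvPolynomial (Fin 2) ℂ} (Dg : RelData u v)

/-- **Per visible point.** A visible point `l` (valid `ξ`) yields a toric point `x₀` over `p · l` (`x₀(a) = 0`) with slice
coordinates `(x₀(b), x₀(c)) ≤ (q m + p m, r m + p m)`, whose reduced exponent `x̂₀` is a zero-avoiding STRICT minimiser of the
letter-weight functional on `{ν : F_{x₀(b), x₀(c)}(ν) ≠ 0}` over ALL of `ℕ^s`. [folklore] -/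
theorem RelData.sliceMin_of_visible (hu : ∀ j, coeff 0 (u j) = 0) (hv : ∀ j, coeff 0 (v j) = 0)
    (hinj : Set.InjOn (piE Dg.enumP) ↑Dg.GT.support) (ξ : Fin 2 → ℝ) (hval : ValidWeight u v ξ) (l : Expo)
    (htop : IsStrictTop ξ ↑(tailDiff u v).support l) :
    ∃ x₀ : Fin (sE u v) →₀ ℕ, piE Dg.enumP x₀ = Dg.p • l ∧ x₀ Dg.idx.a = 0 ∧ x₀ Dg.idx.b ≤ Dg.q * m + Dg.p * m ∧
      x₀ Dg.idx.c ≤ Dg.r * m + Dg.p * m ∧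
      Fsl Dg.idx (cU u v) (cV u v) (x₀ Dg.idx.b) (x₀ Dg.idx.c) (xhat Dg.idx x₀) ≠ 0 ∧
      ∀ ν : Fin (sE u v) → ℕ, ν ≠ ⇑(xhat Dg.idx x₀) → Fsl Dg.idx (cU u v) (cV u v) (x₀ Dg.idx.b) (x₀ Dg.idx.c) ν ≠ 0 →
        ∑ i, Dg.rWP ξ i * ((xhat Dg.idx x₀ i : ℕ) : ℝ) < ∑ i, Dg.rWP ξ i * (ν i : ℝ) := by
  classical
  have _hu := hu; have _hv := hv
  obtain ⟨x₀, hx₀, hπ, hmin⟩ := Dg.lifted_of_visible hinj ξ l htop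
  obtain ⟨L₀, hL₀, hx₀L⟩ := Dg.exists_of_mem_support_GT x₀ hx₀
  have hx₀a : x₀ Dg.idx.a = 0 := Dg.apply_a_of_mem_support_GT x₀ hx₀
  have hdegL : deg L₀ ≤ m := deg_le_of_mem_support_liftG _ _ L₀ hL₀
  have hsumL := deg_eq_sum L₀
  rw [sum_three_split Dg.idx] at hsumL
  have hLa : L₀ Dg.idx.a ≤ m := by omega
  have hLb : L₀ Dg.idx.b ≤ m := by omega
  have hLc : L₀ Dg.idx.c ≤ m := by omega
  have hb_le : x₀ Dg.idx.b ≤ Dg.q * m + Dg.p * m := by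
    rw [← hx₀L, piT_frM_b, Dg.idx_q, Dg.idx_p]
    have hqa : Dg.q * L₀ Dg.idx.a ≤ Dg.q * m := Nat.mul_le_mul_left _ hLa
    have hpb : Dg.p * L₀ Dg.idx.b ≤ Dg.p * m := Nat.mul_le_mul_left _ hLb
    omega
  have hc_le : x₀ Dg.idx.c ≤ Dg.r * m + Dg.p * m := by
    rw [← hx₀L, piT_frM_c, Dg.idx_r, Dg.idx_p]
    have hra : Dg.r * L₀ Dg.idx.a ≤ Dg.r * m := Nat.mul_le_mul_left _ hLa
    have hpc : Dg.p * L₀ Dg.idx.c ≤ Dg.p * m := Nat.mul_le_mul_left _ hLc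
    omega
  -- the upstairs weights and their normalisation
  set θ : Fin (sE u v) → ℝ := Dg.rWP ξ with hθdef
  have hθpos : ∀ i, 0 < θ i := Dg.rWP_pos ξ hval
  have hne : (Finset.univ : Finset (Fin (sE u v))).Nonempty := ⟨Dg.idx.a, Finset.mem_univ _⟩
  set θmin : ℝ := Finset.univ.inf' hne θ with hθmin
  have hθmin_pos : 0 < θmin := by
    obtain ⟨i, -, hi⟩ := Finset.exists_mem_eq_inf' hne θ
    rw [hθmin, hi]; exact hθpos i
  have hθmin_le : ∀ i, θmin ≤ θ i := fun i => Finset.inf'_le θ (Finset.mem_univ i)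
  set θ' : Fin (sE u v) → ℝ := fun i => θ i / θmin with hθ'
  have hθ'1 : ∀ i, 1 ≤ θ' i := fun i => by
    rw [hθ']; simp only; rw [le_div_iff₀ hθmin_pos, one_mul]; exact hθmin_le i
  have hlwt' : ∀ x : Fin (sE u v) →₀ ℕ, lwt θ' x = lwt θ x / θmin := fun x => by
    unfold lwt; rw [Finset.sum_div]
    refine Finset.sum_congr rfl fun i _ => ?_
    rw [hθ']; ring
  have hlwtG : ∀ x ∈ Dg.GT.support, lwt θ x = -wt ξ (piE Dg.enumP x) := fun x _ => Dg.lwt_rWP ξ x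
  have hminθ' : x₀ ∈ (phiT (frM Dg.idx) (liftG (cU u v) (cV u v))).support ∧
      ∀ x ∈ (phiT (frM Dg.idx) (liftG (cU u v) (cV u v))).support, x ≠ x₀ → lwt θ' x₀ < lwt θ' x := by
    refine ⟨hx₀, fun x hx hne' => ?_⟩
    rw [hlwt', hlwt']
    apply div_lt_div_of_pos_right _ hθmin_pos
    rw [hlwtG x₀ hx₀, hlwtG x hx, hπ]
    linarith [hmin x hx hne']
  have hA := toric_minLog (frM Dg.idx) (frM_ne_zero Dg.idx) θ' hθ'1 (cU u v) (cV u v) x₀ hminθ'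
  set R : ℕ := ⌊lwt θ' x₀⌋₊ + 1 with hRdef
  have hRlt : lwt θ' x₀ < R := by rw [hRdef]; push_cast; exact Nat.lt_floor_add_one _
  -- `x₀ ≠ 0` and `deg x₀ ≤ R`
  have hx₀ne : x₀ ≠ 0 := by
    intro h0
    have := mem_support_iff.mp hx₀
    apply this
    rw [h0]
    unfold RelData.GT
    rw [phiT_liftG, coeff_sub,
      coeff_zero_prod_eq_one _ (fun j => coeff_zero_one_add_phiT_lin (frM Dg.idx) (frM_ne_zero Dg.idx) _),
      coeff_zero_prod_eq_one _ (fun j => coeff_zero_one_add_phiT_lin (frM Dg.idx) (frM_ne_zero Dg.idx) _), sub_self]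
  have hdegR : deg x₀ ≤ R := by
    have h2 : (deg x₀ : ℝ) ≤ lwt θ' x₀ := deg_le_lwt θ' hθ'1 x₀
    have h3 : (deg x₀ : ℝ) < R := lt_of_le_of_lt h2 hRlt
    have h4 : deg x₀ < R := by exact_mod_cast h3
    omega
  have hF0 : Fsl Dg.idx (cU u v) (cV u v) (x₀ Dg.idx.b) (x₀ Dg.idx.c) (xhat Dg.idx x₀) ≠ 0 :=
    (mem_support_free_logTrunc_iff Dg.idx (cU u v) (cV u v) R x₀ hx₀a hx₀ne hdegR).mp hA.1
  refine ⟨x₀, hπ, hx₀a, hb_le, hc_le, hF0, fun ν hν hFν => ?_⟩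
  obtain ⟨hνa, hνb, hνc⟩ := shape_of_Fsl_ne_zero Dg.idx (cU u v) (cV u v) _ _ ν hFν
  set x' : Fin (sE u v) →₀ ℕ := xOf Dg.idx (x₀ Dg.idx.b) (x₀ Dg.idx.c) ν with hx'def
  have hx'a : x' Dg.idx.a = 0 := xOf_a Dg.idx _ _ ν
  have hxh' : ⇑(xhat Dg.idx x') = ν := xhat_xOf Dg.idx _ _ ν hνa hνb hνc
  have hx'b : x' Dg.idx.b = x₀ Dg.idx.b := xOf_b Dg.idx _ _ ν
  have hx'c : x' Dg.idx.c = x₀ Dg.idx.c := xOf_c Dg.idx _ _ ν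
  have hne' : x' ≠ x₀ := by
    intro h; apply hν; rw [← hxh', h]
  have hx'ne : x' ≠ 0 := by
    intro hz
    have hνz : ∀ j, ν j = 0 := fun j => by rw [← hxh', hz]; simp [xhat]
    have hb0 : x₀ Dg.idx.b = 0 := by rw [← hx'b, hz]; rfl
    have hc0 : x₀ Dg.idx.c = 0 := by rw [← hx'c, hz]; rfl
    apply hFν
    rw [hb0, hc0]; exact Fsl_zero_zero Dg.idx (cU u v) (cV u v) ν hνz
  have hlt' : lwt θ' x₀ < lwt θ' x' := by
    by_cases hR' : deg x' ≤ R
    · have hmem : x' ∈ (phiT (frM Dg.idx) (logTrunc (cU u v) (cV u v) R)).support :=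
        (mem_support_free_logTrunc_iff Dg.idx (cU u v) (cV u v) R x' hx'a hx'ne hR').mpr
          (by rw [hx'b, hx'c, hxh']; exact hFν)
      exact hA.2 x' hmem hne'
    · push Not at hR'
      have h2 : (deg x' : ℝ) ≤ lwt θ' x' := deg_le_lwt θ' hθ'1 x'
      have h3 : (R : ℝ) < deg x' := by exact_mod_cast hR'
      linarith
  have hlt : lwt θ x₀ < lwt θ x' := by
    have := hlt'
    rw [hlwt', hlwt'] at this
    exact (div_lt_div_iff_of_pos_right hθmin_pos).mp this
  rw [lwt_split Dg.idx θ x₀ hx₀a, lwt_split Dg.idx θ x' hx'a, hx'b, hx'c] at hlt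
  rw [hxh'] at hlt
  linarith

/-- The uniform width surrogate `N_m = 2 m (4 m² + 1)^2 + 1 ≥ |R7a.SIdx m b₁ b₂|` (`b₁, b₂ ≤ 2 m²`). [folklore] -/
def Nm8 (m : ℕ) : ℕ := 2 * m * (4 * (m * m) + 1) ^ 2 + 1

/-- The slice bound, uniform in `b₁, b₂ ≤ 2 m²`. [folklore] -/
def sliceBd8 (m s : ℕ) : ℕ := (s + 2) ^ 3 * (Nm8 m + 2) ^ (3 * (Nat.log 2 (Nm8 m + 2) + 1))

/-- **The per-slice count** from finite shift rank (val-lit-p3's `ShiftRank.pencilCount`, BY NAME). [folklore] -/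
theorem sliceCount (b₁ b₂ : ℕ) (hb : b₁ + b₂ ≤ 4 * (m * m)) (U V : Fin (sE u v) → ℝ) (Sb : Finset (Fin (sE u v) → ℕ))
    (hhyp : ∀ μ ∈ Sb, Fsl Dg.idx (cU u v) (cV u v) b₁ b₂ μ ≠ 0 ∧ ∃ t : ℝ, ∀ ν : Fin (sE u v) → ℕ, ν ≠ μ →
      Fsl Dg.idx (cU u v) (cV u v) b₁ b₂ ν ≠ 0 → ∑ i, (U i + t * V i) * (μ i : ℝ) < ∑ i, (U i + t * V i) * (ν i : ℝ)) :
    Sb.card ≤ sliceBd8 m (sE u v) := by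
  obtain ⟨col, ch, hF⟩ := Fsl_shift Dg.idx (cU u v) (cV u v) b₁ b₂
  have h1 := ShiftRank.pencilCount hF U V Sb hhyp
  rw [R7a.card_SIdx] at h1
  have h2 := BinExpSum.pencilCount_arith (sE u v) (2 * m * (b₁ + b₂ + 1) ^ 2 + 1)
  have h3 : 2 * m * (b₁ + b₂ + 1) ^ 2 + 1 ≤ Nm8 m :=
    Nat.add_le_add_right (Nat.mul_le_mul_left _ (Nat.pow_le_pow_left (by omega) 2)) 1
  exact h1.trans (h2.trans (toolBound_mono (sE u v) 3 h3))


end FreeCount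

end R7b
end Summit.ValiantsHypothesis.ValiantsHypothesis.Theorems.NewtonUnitEquations.TwoProducts.PermutationType

end
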